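import Summits.Ventures.PercRepro.S2ThirteenSeven
import Summits.Ventures.PercRepro.S2ThirteenSevenNuFour
import Summits.Ventures.PercRepro.S2TwelveSevenK1NuFour
import Summits.Ventures.PercRepro.S2ElevenSevenK2NuFour

/-!
# PercRepro — S2: THE CELL `(13, 7)` MODULO ITS COLOOP-FREE SPREAD CASE, AND MODULO p1's PLANE-POOR `8`-SPREAD TABLE (p7, gen 17;
sub-claim S2; the second cell of the row `p = 13`)

The double coloop split `c025_core_five_thirteen_seven_of_cells` with its three sub-cells discharged: the twice-scaled cell `(11, 7)`
at `K₂` (`c025_eleven_seven_k2`, unconditional, coloops allowed), the scaled coloop-free cell `(12, 7)` at `K₁`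
(`c025_twelve_seven_cfk1`, unconditional) and the coloop-free cell `(13, 7)` modulo its spread case
(`c025_thirteen_seven_cf_of_spread`) — **`c025_core_five_thirteen_seven_of_spread`**: `RLS M 13 5` on every `e`-free core of rank `13`
on `20` points, MODULO the coloop-free spread case of `(13, 7)` (the hypothesis `hspread`). With the spread case of
`S2ThirteenSevenSpread`, which rests on p1 g33's `s₅ ≤ 146` modulo the plane-poor `8`-spread table at nullities `3 … 6`:
**`c025_core_five_thirteen_seven_of_table (ht : the table) (M) [M.Finite] (hR : eRank = 13) (hn : |E| = 13 + 7) (hfree) : RLS M 13 5`**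
— THE CELL `(13, 7)`, CONDITIONAL ON THE TABLE. Nothing beyond these statements is claimed; the window move is the lead's. Axioms:
standard.
-/

open scoped Matroid

namespace PercRepro

namespace ThmN

open Set

variable {α : Type}

/-- **The cell `(13, 7)` modulo the coloop-free spread case**: the double coloop split with the sub-cells `(11, 7)` at `K₂` and
`(12, 7)` at `K₁` discharged unconditionally and the coloop-free cell reduced to its spread case. -/
theorem c025_core_five_thirteen_seven_of_spread
    (hspread : ∀ (M : Matroid α) [M.Finite], M.eRank = ((13 : ℕ) : ℕ∞) → M.E.ncard = 13 + 7 →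
      (∀ e ∈ M.E, ∃ A ⊆ M.E \ {e}, e ∉ M.closure A ∧ e ∉ M.closure ((M.E \ {e}) \ A)) → (∀ e, ¬ M.IsColoop e) →
      ¬ (∃ W ⊆ M.E, W.ncard ≤ 9 ∧ W.encard = M.eRk W + 4) → RLS M 13 5)
    (M : Matroid α) [M.Finite]
    (hR : M.eRank = ((13 : ℕ) : ℕ∞)) (hn : M.E.ncard = 13 + 7)
    (hfree : ∀ e ∈ M.E, ∃ A ⊆ M.E \ {e}, e ∉ M.closure A ∧ e ∉ M.closure ((M.E \ {e}) \ A)) : RLS M 13 5 :=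
  c025_core_five_thirteen_seven_of_cells
    (fun M' _ hR' hn' hfree' hK' => c025_thirteen_seven_cf_of_spread hspread M' hR' hn' hfree' hK')
    (fun M' _ hR' hn' hfree' hK' => c025_twelve_seven_cfk1 M' hR' hn' hfree' hK')
    (fun M' _ hR' hn' hfree' => c025_eleven_seven_k2 M' hR' hn' hfree') M hR hn hfree

/-- **The cell `(13, 7)` modulo p1's plane-poor `8`-spread table at nullities `3 … 6`** (the hypothesis `ht` of
`S1.ncard_fiveCircuits_le_one_forty_six_thirteen_seven_of_tPoorSix`, verbatim): `RLS M 13 5` on every `e`-free core of rank `13` on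
`20` points — CONDITIONAL on the table. -/
theorem c025_core_five_thirteen_seven_of_table
    (ht : ∀ (N' : Matroid α) [N'.Finite], S1.PlanePoor N' → S1.Spread8 N' → ∀ j : ℕ, 3 ≤ j → j ≤ 6 →
      N'.E.encard = N'.eRank + j → ∀ f ∈ N'.E,
      {D : Set α | N'.IsCircuit D ∧ D.ncard = 4 ∧ f ∈ D}.ncard ≤ S1.tPoorSix j)
    (M : Matroid α) [M.Finite]
    (hR : M.eRank = ((13 : ℕ) : ℕ∞)) (hn : M.E.ncard = 13 + 7)
    (hfree : ∀ e ∈ M.E, ∃ A ⊆ M.E \ {e}, e ∉ M.closure A ∧ e ∉ M.closure ((M.E \ {e}) \ A)) : RLS M 13 5 :=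
  c025_core_five_thirteen_seven_of_spread
    (fun M' _ hR' hn' hfree' hK' h4' => c025_thirteen_seven_cf_spread_of_table ht M' hR' hn' hfree' hK' h4') M hR hn hfree

end ThmN

end PercRepro
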